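import Summits.BirchSwinnertonDyer.Rank1Residual.P2.KrizLiTwoFortyThreeMembership
import Summits.BirchSwinnertonDyer.Rank1Residual.P2.CornerFTwoModelLocalTwo
import Literature.NumberTheory.EllipticCurves.MordellCurveTateAlgorithmTwoProofs
import Literature.NumberTheory.EllipticCurves.FullTwoTorsionConductorExponentProofs
import Literature.NumberTheory.EllipticCurves.NeronComponentIndexProofs
import Literature.NumberTheory.EllipticCurves.NeronComponentIndexTypeIVstarProofs
import Literature.NumberTheory.EllipticCurves.TamagawaRingEquivProofs
import Literature.NumberTheory.EllipticCurves.SzpiroLocalDataProofs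
import Literature.NumberTheory.EllipticCurves.LFunctionPrimeCoeff
import Literature.NumberTheory.DiophantineGeometry.ConductorRingOfIntegersProofs
import Literature.NumberTheory.DiophantineGeometry.TateAlgorithmAdditiveProofs
import Literature.NumberTheory.DiophantineGeometry.TateAlgorithmProofs
import HarnessLib

/-!
# Cell `bsd-print-cf2` (D-0131 (2) PRINT TIER, leaf CornerF @ `p = 2`), typer ty2 — the Kriz–Li door at
# `j = 0`, GENERIC SETTING AT THE PRIME `2` for the shape `y² = x³ + k` ADDITIVE at `2`: Kodaira type,
# EXACT conductor exponent `f₂`, `c₂(E)` odd — from the tree's Tate algorithm (Silverman *ATAEC* IV.9)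

HONEST FRAMING. Discharge interface (ty2) for Kriz–Li 2019 Thm 5.1 (2) (tree
`KrizLi2019.thm112_bsdTwo_twist`) at the four (★)-CERTIFIED `j = 0` bases that are ADDITIVE at `2`
(cell dossier `run/shared/lean/pub/bsd-print-cf2/DOSSIER.md` §14.4: `972d1 : y² = x³ + 36` (IV*),
`1728a1 : y² = x³ + 2`, `1728v1 : y² = x³ − 2` (II), `3888s1 : y² = x³ + 48` (II*); INERT-BAD quadrant
of crux `InertJZeroOfFacts`, stmt-BirchSwinnertonDyer-20671). Thm 5.1 (2) needs there: `c₂(E)` ODD,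
"`E` additive at `2`" (so that the Manin clause is live), and — for the base `BSD(E, 2)` by
Creutz–Miller / Miller–Stoll (`N < 5000`) and for the sign clause `χ_d(−N) = 1` — the EXACT exponent
`f₂ = ord₂ N(E)`. All three are read off the Kodaira type at `2`, which the tree COMPUTES for
`y² = x³ + k` (`MordellCurveTateAlgorithmTwoProofs`: `k = 4u, u ≡ 1 (4)` ↦ IV*, `ord₂ Δ_min = 8`;
`k = 2u`, `u` odd ↦ II, `6`; `k = 16u, u ≡ 3 (4)` ↦ II*, `12`), combined with Ogg's formula
`f = ord Δ_min + 1 − m` (the tree's DEFINITION of `conductorExponent`), the Néron–Tate component counts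
`c(II) = c(II*) = 1`, `c(IV*) ∈ {1, 3}` (tree `localTamagawaNumber_*_of_kodairaSymbolAt_*_holds`), and
the bridges between the place of `𝓞 ℚ` above `2`, the place of `ℤ` above `2` and `ℚ₂`
(`conductorExponent_eq_of_primesEquiv_eq`, `localTamagawaNumber_padic_eq_holds`,
`hasGoodReductionAtPrime_iff_hasGoodReductionAt_ringOfIntegers`). GENERIC in `u`; the companion files
`KrizLiNineSeventyTwo.lean`, `KrizLiSeventeenTwentyEight.lean` instantiate. Also here: the arithmetic
step `N ∣ 3ⁱ·2ᵃ ∧ ord₂ N = e ⇒ N ∣ 3ⁱ·2ᵉ`, the `a_ℓ`-parity and twist/CM lemmas of the shape (the twist itself is the tree's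
`quadraticTwist_mk_a₆`), and Kriz–Li's local clause from an odd Manin constant. No named fact; nothing beyond kernel theorems; the
leaf is OPEN AS A CLASS; Assumption (★) is never stated here.

References: [SilvermanATAEC1994] IV.9.4 (Tate's algorithm), Table 4.1, IV.10.2, IV.11.1 (Ogg);
[KrizLi2019] Thm 5.1 (2) hypotheses ("c₂(E) odd; if E has additive reduction at 2, Manin constant
odd"); [SilvermanAEC2009] VII.5 Prop. 5.1, VII.6, X.5; cell dossier §14.4.
-/

noncomputable section

open scoped Classical

open WeierstrassCurve NumberField Literature.NumberTheory.EllipticCurves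
  Literature.NumberTheory.EllipticCurves.Rank1Residual
  Literature.NumberTheory.EllipticCurves.ModularForms
  Summit.BirchSwinnertonDyer.Rank1Residual IsDedekindDomain Rat.HeightOneSpectrum
  Literature.NumberTheory.DiophantineGeometry

set_option autoImplicit false

namespace Summit.BirchSwinnertonDyer.Rank1Residual.P2

/-! ## §1 The place of `𝓞 ℚ` above `2` and the transfer to `ℚ₂` / to `N(E)` -/

/-- The place of `𝓞 ℚ` above `2` (the index of the tree's Tate-algorithm theorems). [folklore] -/
abbrev placeTwo𝓞 : HeightOneSpectrum (𝓞 ℚ) :=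
  (Rat.HeightOneSpectrum.primesEquiv (R := 𝓞 ℚ)).symm ⟨2, Nat.prime_two⟩

/-- `primesEquiv placeTwo𝓞 = 2`. [folklore] -/
theorem primesEquiv_placeTwo𝓞 : Rat.HeightOneSpectrum.primesEquiv placeTwo𝓞 = ⟨2, Nat.prime_two⟩ :=
  Equiv.apply_symm_apply _ _

/-- `natGenerator placeTwo𝓞 = 2`. [folklore] -/
theorem natGenerator_placeTwo𝓞 : natGenerator placeTwo𝓞 = 2 := congrArg Subtype.val primesEquiv_placeTwo𝓞

/-- **From the Kodaira type at `2` to Kriz–Li's data at `2`.** If Tate's algorithm at the place above `2`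
returns an ADDITIVE type `T` with `ord₂ Δ_min = n`, and `c₂` (read at that place) is odd, then:
`ord₂ N(E) = n + 1 − m(T)` (Ogg's formula, the tree's definition of `f`), `c₂(E)` is odd in the `ℚ₂`-form
used by `KrizLi2019.AssumptionStar` / `thm112_bsdTwo_twist`, `E` is additive at the place above `2`, and
`E` does not have good reduction at the prime `2`. [cite: SilvermanATAEC1994, IV.11.1 (Ogg's formula) and Table 4.1]
[cite: SilvermanAEC2009, VII.5 Prop. 5.1] -/
theorem krizLi_at_two_of_kodairaSymbolAt (W : WeierstrassCurve ℚ) [W.IsElliptic] {T : KodairaSymbol} {n : ℕ}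
    (hK : W.kodairaSymbolAt placeTwo𝓞 = T ∧ W.ordMinimalDiscriminant placeTwo𝓞 = n) (hT : T.IsAdditive)
    (hodd : Odd ((W.baseChange (placeTwo𝓞.adicCompletion ℚ)).localTamagawaNumber
      (placeTwo𝓞.adicCompletionIntegers ℚ))) :
    haveI : Fact (Nat.Prime 2) := ⟨Nat.prime_two⟩
    (W.conductorNorm ℤ).factorization 2 = n + 1 - T.numComponents ∧
      Odd ((W.baseChange ℚ_[2]).localTamagawaNumber ℤ_[2]) ∧
      W.HasAdditiveReductionAt placeTwo𝓞 ∧ ¬ W.HasGoodReductionAtPrime 2 ∧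
      ¬ W.HasMultiplicativeReductionAtPrime 2 := by
  haveI : Fact (Nat.Prime 2) := ⟨Nat.prime_two⟩
  -- Ogg's formula at the place of `𝓞 ℚ`, transferred to the place of `ℤ`, i.e. to `ord₂ N(E)`
  have hf' : W.conductorExponent placeTwo𝓞 = n + 1 - T.numComponents := by
    unfold WeierstrassCurve.conductorExponent WeierstrassCurve.numComponentsAt
    rw [hK.1, hK.2]
  set v : HeightOneSpectrum ℤ := (Rat.HeightOneSpectrum.primesEquiv (R := ℤ)).symm ⟨2, Nat.prime_two⟩ with hvdef
  have hv : Rat.HeightOneSpectrum.primesEquiv v = ⟨2, Nat.prime_two⟩ := Equiv.apply_symm_apply _ _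
  have hff' : W.conductorExponent v = W.conductorExponent placeTwo𝓞 :=
    conductorExponent_eq_of_primesEquiv_eq v placeTwo𝓞 W (by rw [hv, primesEquiv_placeTwo𝓞])
  have hfac : (W.conductorNorm ℤ).factorization 2 = n + 1 - T.numComponents := by
    have h := factorization_conductorNorm_primesEquiv_symm W ⟨2, Nat.prime_two⟩
    rw [← hvdef, hff', hf'] at h
    exact h
  -- `c₂` in the `ℚ₂`-form
  have hc : Odd ((W.baseChange ℚ_[2]).localTamagawaNumber ℤ_[2]) := by
    rw [WeierstrassCurve.localTamagawaNumber_padic_eq_holds W placeTwo𝓞 2 (congrArg Subtype.val primesEquiv_placeTwo𝓞)]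
    exact hodd
  -- additive at the place, hence not good at the prime
  have hadd : W.HasAdditiveReductionAt placeTwo𝓞 :=
    (WeierstrassCurve.isAdditive_kodairaSymbolAt_iff_holds placeTwo𝓞 W).mp (by rw [hK.1]; exact hT)
  have keyg : ∀ q : Nat.Primes, Rat.HeightOneSpectrum.primesEquiv placeTwo𝓞 = q →
      (haveI := Fact.mk q.2; W.HasGoodReductionAtPrime (q : ℕ)) → W.HasGoodReductionAt placeTwo𝓞 := by
    rintro q hq h
    rw [← hq] at h
    exact (hasGoodReductionAtPrime_iff_hasGoodReductionAt_ringOfIntegers (v := placeTwo𝓞) W).mp h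
  have keym : ∀ q : Nat.Primes, Rat.HeightOneSpectrum.primesEquiv placeTwo𝓞 = q →
      (haveI := Fact.mk q.2; W.HasMultiplicativeReductionAtPrime (q : ℕ)) →
        W.HasMultiplicativeReductionAt placeTwo𝓞 := by
    rintro q hq h
    rw [← hq] at h
    exact (hasMultiplicativeReductionAtPrime_iff_hasMultiplicativeReductionAt_ringOfIntegers W placeTwo𝓞).mp h
  have hng : ¬ W.HasGoodReductionAtPrime 2 := fun hg =>
    hadd.not_hasGoodReductionAt (keyg ⟨2, Nat.prime_two⟩ primesEquiv_placeTwo𝓞 hg)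
  have hnm : ¬ W.HasMultiplicativeReductionAtPrime 2 := fun hm =>
    hadd.not_hasMultiplicativeReductionAt (keym ⟨2, Nat.prime_two⟩ primesEquiv_placeTwo𝓞 hm)
  exact ⟨hfac, hc, hadd, hng, hnm⟩


/-! ## §2 The three additive shapes of `y² = x³ + k` used by the certified bases -/

/-- **`y² = x³ + 4u`, `u ≡ 1 (mod 4)`** (`972d1`: `k = 36`; its twists `36d³`, `d ≡ 1 (mod 4)`): type IV*
at `2`, so **`ord₂ N = 2`, `c₂ ∈ {1, 3}` is odd, additive at `2`**.
[cite: SilvermanATAEC1994, IV.9.4 and Table 4.1 (IV*: m = 7, c ∈ {1,3}); IV.11.1] -/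
theorem krizLi_at_two_mordell_four_mul (W : WeierstrassCurve ℚ) [W.IsElliptic]
    (h₁ : W.a₁ = 0) (h₂ : W.a₂ = 0) (h₃ : W.a₃ = 0) (h₄ : W.a₄ = 0) {u : ℤ} (hu : u % 4 = 1)
    (ha₆ : W.a₆ = ((4 * u : ℤ) : ℚ)) :
    haveI : Fact (Nat.Prime 2) := ⟨Nat.prime_two⟩
    (W.conductorNorm ℤ).factorization 2 = 2 ∧ Odd ((W.baseChange ℚ_[2]).localTamagawaNumber ℤ_[2]) ∧
      W.HasAdditiveReductionAt placeTwo𝓞 ∧ ¬ W.HasGoodReductionAtPrime 2 ∧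
      ¬ W.HasMultiplicativeReductionAtPrime 2 := by
  have hK := W.kodairaSymbolAt_and_ordMinimalDiscriminant_mordell_two_of_emod_four_eq_one placeTwo𝓞
    natGenerator_placeTwo𝓞 h₁ h₂ h₃ h₄ hu ha₆
  have hc := localTamagawaNumber_of_kodairaSymbolAt_eq_IVstar_holds placeTwo𝓞 W hK.1
  have hodd : Odd ((W.baseChange (placeTwo𝓞.adicCompletion ℚ)).localTamagawaNumber
      (placeTwo𝓞.adicCompletionIntegers ℚ)) := by
    rcases hc with h | h <;> rw [h] <;> decide
  exact krizLi_at_two_of_kodairaSymbolAt W hK (by decide) hodd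

/-- **`y² = x³ + 2u`, `u` odd** (`1728a1`: `k = 2`; `1728v1`: `k = −2`; their twists `±2d³`): type II at
`2`, so **`ord₂ N = 6`, `c₂ = 1`, additive at `2`**.
[cite: SilvermanATAEC1994, IV.9.4 and Table 4.1 (II: m = 1, c = 1); IV.11.1] -/
theorem krizLi_at_two_mordell_two_mul (W : WeierstrassCurve ℚ) [W.IsElliptic]
    (h₁ : W.a₁ = 0) (h₂ : W.a₂ = 0) (h₃ : W.a₃ = 0) (h₄ : W.a₄ = 0) {u : ℤ} (hu : ¬ (2 : ℤ) ∣ u)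
    (ha₆ : W.a₆ = ((2 * u : ℤ) : ℚ)) :
    haveI : Fact (Nat.Prime 2) := ⟨Nat.prime_two⟩
    (W.conductorNorm ℤ).factorization 2 = 6 ∧ Odd ((W.baseChange ℚ_[2]).localTamagawaNumber ℤ_[2]) ∧
      W.HasAdditiveReductionAt placeTwo𝓞 ∧ ¬ W.HasGoodReductionAtPrime 2 ∧
      ¬ W.HasMultiplicativeReductionAtPrime 2 := by
  have hK := W.kodairaSymbolAt_and_ordMinimalDiscriminant_mordell_one placeTwo𝓞
    natGenerator_placeTwo𝓞 h₁ h₂ h₃ h₄ hu ha₆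
  have hc := localTamagawaNumber_eq_one_of_kodairaSymbolAt_eq_II_holds placeTwo𝓞 W hK.1
  exact krizLi_at_two_of_kodairaSymbolAt W hK (by decide) (by rw [hc]; exact odd_one)

/-- **`y² = x³ + 16u`, `u ≡ 3 (mod 4)`** (`3888s1`: `k = 48`; its twists `48d³`, `d ≡ 1 (mod 4)`): type
II* at `2`, so **`ord₂ N = 4`, `c₂ = 1`, additive at `2`**.
[cite: SilvermanATAEC1994, IV.9.4 and Table 4.1 (II*: m = 9, c = 1); IV.11.1] [cite: Kraus1989, Prop. 2] -/
theorem krizLi_at_two_mordell_sixteen_mul (W : WeierstrassCurve ℚ) [W.IsElliptic]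
    (h₁ : W.a₁ = 0) (h₂ : W.a₂ = 0) (h₃ : W.a₃ = 0) (h₄ : W.a₄ = 0) {u : ℤ} (hu : u % 4 = 3)
    (ha₆ : W.a₆ = ((16 * u : ℤ) : ℚ)) :
    haveI : Fact (Nat.Prime 2) := ⟨Nat.prime_two⟩
    (W.conductorNorm ℤ).factorization 2 = 4 ∧ Odd ((W.baseChange ℚ_[2]).localTamagawaNumber ℤ_[2]) ∧
      W.HasAdditiveReductionAt placeTwo𝓞 ∧ ¬ W.HasGoodReductionAtPrime 2 ∧
      ¬ W.HasMultiplicativeReductionAtPrime 2 := by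
  have hK := W.kodairaSymbolAt_and_ordMinimalDiscriminant_mordell_four_of_emod_four_eq_three placeTwo𝓞
    natGenerator_placeTwo𝓞 h₁ h₂ h₃ h₄ hu ha₆
  have hc := localTamagawaNumber_eq_one_of_kodairaSymbolAt_eq_IIstar_holds placeTwo𝓞 W hK.1
  exact krizLi_at_two_of_kodairaSymbolAt W hK (by decide) (by rw [hc]; exact odd_one)

/-! ## §3 Kriz–Li's local clause at an additive base; the conductor arithmetic -/

/-- **Kriz–Li's local hypotheses at `2` for a base ADDITIVE at `2`**: `c₂(E)` odd and the Manin constant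
of the displayed parametrisation odd. [cite: KrizLi2019, Thm. 5.1 hypotheses "c₂(E) odd; if E has additive reduction at 2, its Manin constant is odd"] -/
theorem krizLi_loc_of_odd (W : WeierstrassCurve ℚ) {N : ℕ} [NeZero N] (Dt : ModularParametrizationData W N)
    (hc₂ : haveI : Fact (Nat.Prime 2) := ⟨Nat.prime_two⟩; Odd ((W.baseChange ℚ_[2]).localTamagawaNumber ℤ_[2]))
    (hc : Odd Dt.c) :
    haveI : Fact (2 : ℕ).Prime := ⟨Nat.prime_two⟩
    Odd ((W.baseChange ℚ_[2]).localTamagawaNumber ℤ_[2]) ∧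
      (¬ W.HasGoodReductionAtPrime 2 → ¬ W.HasMultiplicativeReductionAtPrime 2 → Odd Dt.c) :=
  ⟨hc₂, fun _ _ => hc⟩

/-- **`N ∣ 3ⁱ · qᵃ` and `ord_q N = e` give `N ∣ 3ⁱ · qᵉ`** (`q` prime): used to sharpen Ogg's bound
`N ∣ 2⁸·3⁵` by the exact `f₂` from Tate's algorithm. [folklore] -/
theorem dvd_three_pow_mul_pow_of_factorization {N i q a e : ℕ} (hq : q.Prime)
    (hN : N ∣ 3 ^ i * q ^ a) (hf : N.factorization q = e) : N ∣ 3 ^ i * q ^ e := by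
  have hN0 : N ≠ 0 := by
    rintro rfl
    exact (pow_ne_zero a hq.ne_zero) (by simpa using Nat.eq_zero_of_zero_dvd hN |> fun h => (mul_eq_zero.mp h).resolve_left (pow_ne_zero i (by norm_num)))
  have hcop : Nat.Coprime (ordCompl[q] N) (q ^ a) :=
    (Nat.coprime_ordCompl hq hN0).symm.pow_right a
  have hdvd : ordCompl[q] N ∣ 3 ^ i * q ^ a := (Nat.ordCompl_dvd N q).trans hN
  have h3 : ordCompl[q] N ∣ 3 ^ i := hcop.dvd_of_dvd_mul_right hdvd
  rw [← Nat.ordProj_mul_ordCompl_eq_self N q, hf, mul_comm]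
  refine mul_dvd_mul ?_ dvd_rfl
  rwa [← hf]

/-! ## §4 The shape `y² = x³ + k`: twists, CM, `2` inert, `a_ℓ` odd -/

/-- **`j = 0` on every model of every twist of `y² = x³ + k`** (`k ≠ 0`). [cite: SilvermanAEC2009, X.5 Cor. 5.4] -/
theorem j_eq_zero_of_smul_twist_sextic {k d : ℚ} (hk : k ≠ 0) (hd : d ≠ 0) {W : WeierstrassCurve ℚ}
    [W.IsElliptic] {C : VariableChange ℚ} (hC : C • (⟨0, 0, 0, 0, k⟩ : WeierstrassCurve ℚ).quadraticTwist d = W) :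
    W.j = 0 := by
  rw [quadraticTwist_mk_a₆] at hC
  exact CornerFTwo.Atlas.j_eq_zero_of_smul_sextic (mul_ne_zero (pow_ne_zero 3 hd) hk) hC

/-- **Every model of every twist of `y² = x³ + k` has CM and `2` INERT in its CM field `ℚ(√−3)`.**
[cite: SilvermanAEC2009, Appendix C §11] [cite: Cox2013, §5.B Prop. 5.16] -/
theorem hasCM_and_cmInert_two_of_smul_twist_sextic {k d : ℚ} (hk : k ≠ 0) (hd : d ≠ 0)
    {W : WeierstrassCurve ℚ} [W.IsElliptic] {C : VariableChange ℚ}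
    (hC : C • (⟨0, 0, 0, 0, k⟩ : WeierstrassCurve ℚ).quadraticTwist d = W) : W.HasCM ∧ CMInert W 2 := by
  have hj := j_eq_zero_of_smul_twist_sextic hk hd hC
  have hcm : W.HasCM := hasCM_of_j_eq_zero _ hj
  exact ⟨hcm, (cmInert_two_iff_of_hasCM hcm).2 (Or.inl (by rw [hj]; simp [cmFieldDiscrOfJ]))⟩

/-- **No model of a twist `y² = x³ + d³k` is good at `2` when `y² = x³ + d³k` is not** (good reduction
at a prime is a `ℚ`-isomorphism invariant). [cite: SilvermanAEC2009, VII.5 Prop. 5.1 and VII.1 Prop. 1.3(b)] -/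
theorem not_good_two_of_smul_twist_sextic {k d : ℚ} {W : WeierstrassCurve ℚ} {C : VariableChange ℚ}
    (hC : C • (⟨0, 0, 0, 0, k⟩ : WeierstrassCurve ℚ).quadraticTwist d = W)
    (hbad : ¬ Good (⟨0, 0, 0, 0, d ^ 3 * k⟩ : WeierstrassCurve ℚ) 2) : ¬ Good W 2 := by
  rw [quadraticTwist_mk_a₆] at hC
  rw [← hC, Good, hasGoodReductionAtPrime_iff_of_variableChange]
  exact hbad

/-- **`a_ℓ` of a globally minimal `y² = x³ + k` (`k ∈ ℤ`) is odd iff `x³ = −k` has an even number of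
roots mod `ℓ`** (`ℓ` prime, `ℓ ∤ 6k`). [cite: KrizLi2019, Def. 4.1 and arXiv:1606.03172 p. 14 L57–58 ("a_ℓ(E) ≡ 1 (mod 2)")] -/
theorem odd_frobeniusTrace_sextic_iff (k : ℤ) [(⟨0, 0, 0, 0, (k : ℚ)⟩ : WeierstrassCurve ℚ).IsElliptic]
    [(⟨0, 0, 0, 0, (k : ℚ)⟩ : WeierstrassCurve ℚ).IsGloballyMinimal] {ℓ : ℕ} [NeZero ℓ] (hℓ : ℓ.Prime)
    (h2 : ℓ ≠ 2) (hΔ : ¬ (ℓ : ℤ) ∣ (⟨0, 0, 0, 0, k⟩ : WeierstrassCurve ℤ).Δ) :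
    Odd ((⟨0, 0, 0, 0, (k : ℚ)⟩ : WeierstrassCurve ℚ).frobeniusTrace ℓ) ↔
      Even ((Finset.univ.filter fun x : ZMod ℓ => x ^ 3 = -(k : ZMod ℓ)).card) := by
  haveI : Fact ℓ.Prime := ⟨hℓ⟩
  have hsm : (1 : VariableChange ℚ) • (⟨0, 0, 0, 0, (k : ℚ)⟩ : WeierstrassCurve ℚ) = shortWeierstrass (0, k) := by
    rw [one_smul, shortWeierstrass]; push_cast; rfl
  rw [BSZLemma17.frobeniusTrace_eq_of_smul_eq_shortWeierstrass hsm ℓ (by simpa using hΔ),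
    odd_frobeniusTrace_mordell_iff hℓ h2 (by simpa using hΔ)]

/-- `Δ` of the `ℤ`-model `y² = x³ + k` is `−432k² = −2⁴·3³·k²`; a prime `ℓ ∤ 6k` does not divide it. [folklore] -/
theorem not_dvd_Δ_sexticInt {k : ℤ} {ℓ : ℕ} (hℓ : ℓ.Prime) (h2 : ℓ ≠ 2) (h3 : ℓ ≠ 3) (hk : ¬ (ℓ : ℤ) ∣ k) :
    ¬ (ℓ : ℤ) ∣ (⟨0, 0, 0, 0, k⟩ : WeierstrassCurve ℤ).Δ := by
  have hΔ : (⟨0, 0, 0, 0, k⟩ : WeierstrassCurve ℤ).Δ = -(2 ^ 4 * 3 ^ 3 * k ^ 2) := by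
    simp only [WeierstrassCurve.Δ, WeierstrassCurve.b₂, WeierstrassCurve.b₄, WeierstrassCurve.b₆,
      WeierstrassCurve.b₈]
    ring
  rw [hΔ, dvd_neg]
  have hℓp : Prime (ℓ : ℤ) := Nat.prime_iff_prime_int.mp hℓ
  have h2' : ¬ (ℓ : ℤ) ∣ 2 := fun hd =>
    h2 ((Nat.prime_dvd_prime_iff_eq hℓ Nat.prime_two).mp (Int.natCast_dvd_natCast.mp (by exact_mod_cast hd)))
  have h3' : ¬ (ℓ : ℤ) ∣ 3 := fun hd =>
    h3 ((Nat.prime_dvd_prime_iff_eq hℓ Nat.prime_three).mp (Int.natCast_dvd_natCast.mp (by exact_mod_cast hd)))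
  intro h
  rcases hℓp.dvd_or_dvd h with h | h
  · rcases hℓp.dvd_or_dvd h with h | h
    · exact h2' (hℓp.dvd_of_dvd_pow h)
    · exact h3' (hℓp.dvd_of_dvd_pow h)
  · exact hk (hℓp.dvd_of_dvd_pow h)

/-- **The sign clause for conductors `N = 3ᵏ · 2^{2m}`** (even `f₂`: `2, 6, 4` here): for POSITIVE
`d ≡ 1 (mod 12)`, `sgn(d)·(N/|d|) = 1`. [cite: KrizLi2019, Thm. 5.1 (2) condition "χ_d(−N) = 1"] -/
theorem sign_mul_jacobiSym_eq_one_of_eq_three_pow_mul_two_pow {N k m : ℕ} (hN : N = 3 ^ k * 2 ^ (2 * m))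
    {d : ℤ} (hd0 : 0 < d) (hd12 : d % 12 = 1) : Int.sign d * jacobiSym N d.natAbs = 1 := by
  have hN' : N = 3 ^ k * (2 ^ m) ^ 2 := by rw [hN, ← pow_mul, mul_comm 2 m]
  rw [hN', Int.sign_eq_one_of_pos hd0, one_mul, Nat.cast_mul, Nat.cast_pow, Nat.cast_pow, Nat.cast_pow,
    Nat.cast_ofNat, Nat.cast_ofNat, jacobiSym.mul_left]
  have hn4 : d.natAbs % 4 = 1 := by omega
  have hn3 : (d.natAbs : ℤ) % ((3 : ℕ) : ℤ) = 1 % ((3 : ℕ) : ℤ) := by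
    change (d.natAbs : ℤ) % 3 = 1 % 3
    omega
  have h3 : jacobiSym 3 d.natAbs = 1 := by
    have hrec := jacobiSym.quadratic_reciprocity_one_mod_four' (a := 3) (b := d.natAbs) (by decide) hn4
    rw [Nat.cast_ofNat] at hrec
    rw [hrec, jacobiSym.mod_left, hn3, ← jacobiSym.mod_left, jacobiSym.one_left]
  rw [jacobiSym.pow_left, h3, one_pow, one_mul]
  have hodd : Nat.Coprime 2 d.natAbs := (Nat.Prime.coprime_iff_not_dvd Nat.prime_two).mpr (by omega)
  exact jacobiSym.sq_one' (by
    rw [show ((2 : ℤ) ^ m) = ((2 ^ m : ℕ) : ℤ) by push_cast; rfl, Int.gcd_natCast_natCast]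
    exact Nat.Coprime.pow_left m hodd)

end Summit.BirchSwinnertonDyer.Rank1Residual.P2
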